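import Literature.MathematicalPhysics.QuantumFieldTheory.Balaban1983to89.B9Thm310CommutatorSum
import Literature.MathematicalPhysics.QuantumFieldTheory.Balaban1983to89.B9Thm37CutoffGradTerms
import Literature.MathematicalPhysics.QuantumFieldTheory.Balaban1983to89.B9Eq3105Coords
import Literature.MathematicalPhysics.QuantumFieldTheory.Balaban1983to89.Node00.OpsYBondLift

/-!
# `Balaban1983to89.B9Thm310CutoffGradTermsB` — T. Bałaban, *Propagators for lattice gauge theories in a background field*, Commun. Math. Phys. **99** (1985)
# 389–434 [Balaban1985BackgroundPropagators], (3.100) p. 413 + Thm 3.3 (3.42)₂ p. 397∕399: the FORWARD GRADIENT of a localized cube term `h_□G_□(U)h_□` on the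
# BOND sector — `‖∇_{U,μ}(h_□G_□(U)h_□Λ)(b)‖ ≤ B₀(1 + 5C1F·L·e^{δ}∕(8M_h))·ℓ(y)·e^{−δd(y,y′)}|J|` «with (Lʲη)² replaced by Lʲη» — and its localized block
# majorant summed over the cover: the `hTE`∕`hKE` input of FILE 2-B `B9Thm310GTorusRegularEntries` at the cube cover of record (sub-row G-B9-LETTERS, M5.7 FILE 4a-B,
# the bond twin of p21's `B9Thm37CutoffGradTerms` §1∕§3)

statement-level skeleton of published theorems with citation tags; proofs where landed; nothing here is a claim about the Yang–Mills mass gap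

PDF held: `paper:balaban1985-cmp99-background-propagators` (journal page = PDF page + 388); pp. 397, 399, 409–410, 413–414 read from the held text layer; [4] =
[Balaban1984PropagatorsII] p. 234 (after (2.66)) «The similar inequalities hold for a derivative of G′λ … but with (Lʲη)² replaced by Lʲη».

THE PRINT.  p. 413 (3.100): *«(D_U(hA))(b) = h(b₋)(D_UA)(b) + Σ η^{−1}(∂h)(…)R(U(…))A(…) … the commutator [D_U, h] is a multiplication by a function of the order O(M⁻¹)
on a proper scale»* (print's (3.100) l.1–8, the first-order operator «with coefficients determined by derivatives of the function h. They are of the order O(M⁻¹)»,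
p. 414 l.1–2); p. 397 (3.42)₂ *«|(∇_UG′(U)λ)(x)| ≦ B₀Lʲηe^{−δ₀d(y,y′)}|λ|»*; p. 399 Thm 3.3; p. 409 (3.87) *«G₀ = Σ h_□G_□h_□»*.

WHY THIS FILE (cell context: G-B9-LETTERS M5.7; FILE 2-B's `eBlock_kernelFamilyBInv_GAY_of_cubes` ∕ FILE 6-B's `…_of_cover` display, per direction `μ` and cube `□`,
the block majorant `hTE μ □` of `conj b(D_μ)·(h_□·conj b G_□(U)·h_□)` and the summed bound `hKE`).  For a bond cube letter `O` (= `G_□(U)`) whose (3.42)₀,₁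
entries over the class are READ off its block `EBlock (kernelFamilyBInv … O …) B₀ δ U₁` (`B9CubeLettersInvReadDictB.h342₀∕₁_of_eBlockInvB`), p38's (3.100)
`B9Eq3104CutoffCommutators.cdB_cutMulY_apply` splits `∇_{U,μ}(h_□O(h_□Λ))(b)` into `h_□(b₋)·∇_{U,μ}(O(h_□Λ))(b)` — the gradient entry, `≤ B₀ℓ(y)e^{−δd}|J|` — and
`c_f(h_□(b₋+e_μ) − h_□(b₋))·R(U_μ(b₋))(O(h_□Λ))(b′)` with `b′ = ⟨b₋+e_μ, ν⟩` in the NEIGHBOUR block `y₁` (distance ≤ 1, level ≤ lev + 1): the value entry gives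
`B₀ℓ(y₁)²e^{−δd(y₁,y′)}|J|`, the cut-off's Lipschitz size `|∂h_□| ≤ C1F∕(8S_j∕5)` (p38's `abs_hTY_shiftY_sub_le`, `S_j = M_hL^{j+1}`) and `|c_f|ℓ(y₁)² = L^{lev b′}ℓ(y₁)`
with `lev b′ ≤ j + 1` one step from `supp h_□` (p21's `mem_QT_and_lev_of_near`) make it `≤ (5C1F∕(8M_h))·B₀·L·e^{δ}·ℓ(y)e^{−δd(y,y′)}|J|` — print's «O(M⁻¹)».
§2 localizes (the term vanishes unless `h_□(b₋) ≠ 0` or `h_□(b₋+e_μ) ≠ 0`, i.e. `Δ(b)` is within one admissible bond of `QT □` — inside FILE 3-B's sets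
`S′_□ = {a : ∃ y ∈ QT □, d_T(βa,y) ≤ 2L+4}`), §3 converts the ball bound into the block majorant of the conjugated real-coordinate operator
(`B9Thm310CommutatorBound389BMajorant.hasMajorant_conj_of_ball_boundB`, p21's `conj_cutMulY`) in FILE 2-B's literal `hTE` shape, and sums the overlap with FILE 3-B's
`sum_indicator_nearQT_le` into the `hKE` shape `A₁·ℓ(a)·e^{−δd(a,a′)}`.

WHAT IS PROVED (all `theorem`s, 0 `def`, 0 sorry).  §1 ★★ `norm_cdB_hOh_le` (the pointwise bound), §2 `cdB_hOh_apply_eq_zero_of_far`, `exists_nearQT_of_cdB_hOh_ne_zero`;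
§3 ★★ `hasMajorant_conj_gradTermB` (the `hTE μ □` majorant at `GACubeY`, from `hE`), ★★ `sum_gradTermB_majorant_le` (the `hKE μ` bound with
`A₁ = N′·M₂(Σ‖b_j‖)·B₀(1 + 5C1F·L·e^{δ}∕(8M_h))`, `N′ = 3·5^{d+1}e^{αδ(2L+4)}c₁(α)`).
HONEST SCOPE.  Displayed: the cube letter's block `hE`, bi-contractive bond variables `hU` (unitary fibre), `η = |c_f|⁻¹`, (2.61) for the count.  The backward
(`hTF`) and Laplacian (`hTL`) cube terms and the transposed remainder are NOT treated here (PLAN 4b∕4c∕5).  Nothing continuum ∕ OS ∕ mass gap ∕ Clay; YM mass gap NOT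
proved by any of this (Track A conditional rung).  `--supports stmt-QuantumFields-19200`.  Net new unproved facts: 0.
-/

noncomputable section

namespace Literature.MathematicalPhysics.QuantumFieldTheory.Balaban1983to89.B9Thm310CutoffGradTermsB

open Node00 B9CubeLettersInvReadings
open B9Thm37CubeCoverCommutators (cutMulY cutMulY_apply hTY)
open B9Thm37CubeCoverCommutatorSizes (side_conditions four_le_P' abs_hTY_shiftY_sub_le)
open B9Thm37CommutatorBound389 (norm_cutMulY_le_of_le lev_le_succ_of_touch torusSupNorm_sub_shiftY_le_one dist_blkOf_le_one_of_touch)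
open B9Thm37CutoffGradTerms (mem_QT_and_lev_of_near len_eq_pow_mul_eta torusSupNorm_sub_self_le_one)
open B9Eq3104CutoffCommutators (hBdY hBdY_apply cdB_cutMulY_apply)
open B9Thm310CommutatorBound389BMajorant (hasMajorant_conj_of_ball_boundB norm_liftY_le_abs)
open B9Thm310CommutatorSum (sum_indicator_nearQT_le)
open B9CubeLettersInvReadDictB (h342₀_of_eBlockInvB h342₁_of_eBlockInvB)
open B9CubeLettersBondOpsL0 (GACubeY)
open B9Thm39CinvTorusRegular (conj_cutMulY)
open B9Thm37Sum (mulOp)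
open Node00.OpsYBondLift (cdBC cdBC_apply)
open B6KLevelCensusIndexV1 (KIdx)
open B6Ineq2142KLevelV1 (β)
open B6GlobalChartV1 (blkV1)
open B6Geom246MultiLevelBox (bset blkOf)
open B6Geom246MultiLevelTorus (bondT connectedT)
open B6Cover236MultiLevelBlocks (cubes)
open B6MultiLevelBoxOperator (bigSide bigSide_eq)
open B6Partition118KLevelTorus (abs_hT_le_one)
open B6Partition118KLevelTorusCentral (QT blkOf_mem_QT_of_hT_ne_zero)
open B6Partition118KLevelFineSizes (C1F C1F_nonneg)
open B6RandomWalk (HasMajorant Ineq261 hasMajorant_mono)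
open B9Thm34Ext (toB6)
open B9FromB6 (EBlock)
open B9GeoNormsKLevelV1 (geo9K geo9K_supNorm_nonneg)
open B9GeoLemma21KLevelV1 (geo9K_dist_eq)
open B9Ineq349SiteComposite (etaS_pos)
open B9Eq352DivFormLetters (conj)
open B9Eq39Adjoint (R)
open B9Eq310Hermitian (norm_R_le)
open Node00.OpsYNablaBridge (chartY shiftY_chartY)
open B4TorusKernel.MultiPeriod (torusSupNorm)
open scoped Matrix

variable {𝔸 : Type} [NormedRing 𝔸] [NormedAlgebra ℂ 𝔸] [CompleteSpace 𝔸]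
variable {d ℓ : ℕ} {hd : 1 ≤ d + 1} {hL : Odd (ℓ + 1) ∧ 1 < ℓ + 1} {b₀ b₁ : ℝ}
variable {ι : Type} [Fintype ι]
variable (i : KIdx d ℓ hd hL b₀ b₁) (b : Module.Basis ι ℝ 𝔸)

/-! ## §1 (3.100) ⇒ the forward gradient of `h_□O(h_□Λ)` at a bond, «with (Lʲη)² replaced by Lʲη» -/

section Pointwise

variable (U : CfgY 𝔸 i) (O : (FBondY i → 𝔸) →ₗ[ℂ] (FBondY i → 𝔸)) {B₀ δ : ℝ}

/-- ★★ **THE FORWARD GRADIENT OF A LOCALIZED CUBE TERM, BOND SECTOR**: for a bond cube letter `O` with the (3.42)₀,₁ entries `(B₀, δ)` over the class (READ shapes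
`h342₀`, `h342₁`), bi-contractive bond variables, a corner-free member with `η = |c_f|⁻¹`, every `Λ` of the class of `J` (`supp J ⊂ Δ(βy′)`) and every bond `b ∈ Δ(βy)`:
`‖∇_{U,μ}(h_□O(h_□Λ))(b)‖ ≤ B₀(1 + 5C1F·L·e^{δ}∕(8M_h))·ℓ(y)·e^{−δd(y,y′)}·|J|` — (3.100): the cut-off passes through at the cost of the commutator term
`c_f(h_□(b₋+e_μ) − h_□(b₋))R(U_μ(b₋))(O(h_□Λ))(b′)`, read in the neighbour block (`lev b′ ≤ lev b + 1`, `d(y₁,y′) ≥ d(y,y′) − 1`) one step from `supp h_□`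
(`lev b′ ≤ j + 1`), with `|∂h_□| ≤ C1F∕(8S_j∕5)`, `S_j = M_hL^{j+1}`. [cite: Balaban1985BackgroundPropagators, (3.100) p.413, p.414 l.1–2 («of the order O(M⁻¹)»), Thm 3.3 p.399 with (3.42)₁,₂ p.397; Balaban1984PropagatorsII, p.234, (2.2) p.224] -/
theorem norm_cdB_hOh_le (c : ↥(cubes i.D.toDomains)) (hB₀ : 0 ≤ B₀) (hδ : 0 ≤ δ) (hη : etaS i = |i.cf|⁻¹)
    (ιB : BlkY i → IBondY i) (hι : ∀ s, β i.hN i.D i.hk (ιB s) = s)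
    (hU : ∀ μ x, ‖(U μ x : 𝔸)‖ ≤ 1 ∧ ‖(((U μ x)⁻¹ : 𝔸ˣ) : 𝔸)‖ ≤ 1)
    (h342₀ : ∀ (J : FBondY i → ℝ) (y y' : IBondY i), (geo9K i).suppIn (Sum.inr J) y' →
      ∀ Λ : FBondY i → 𝔸, (∀ x, ‖Λ x‖ ≤ |J x|) → ∀ x : FBondY i, blkV1 i.hN i.D x = β i.hN i.D i.hk y →
        ‖O Λ x‖ ≤ B₀ * (geo9K i).len y ^ 2 * Real.exp (-(δ * (geo9K i).dist y y')) * (geo9K i).supNorm (Sum.inr J))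
    (h342₁ : ∀ (J : FBondY i → ℝ) (y y' : IBondY i), (geo9K i).suppIn (Sum.inr J) y' →
      ∀ Λ : FBondY i → 𝔸, (∀ x, ‖Λ x‖ ≤ |J x|) → ∀ (x : FBondY i) (ν : Fin (d + 1)), blkV1 i.hN i.D x = β i.hN i.D i.hk y →
        ‖cdB i U ν (O Λ) x‖ ≤ B₀ * (geo9K i).len y * Real.exp (-(δ * (geo9K i).dist y y')) * (geo9K i).supNorm (Sum.inr J))
    (J : FBondY i → ℝ) (y y' : IBondY i) (hs : (geo9K i).suppIn (Sum.inr J) y')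
    (Λ : FBondY i → 𝔸) (hΛ : ∀ x, ‖Λ x‖ ≤ |J x|) (μ : Fin (d + 1)) (bd : FBondY i) (hb : blkV1 i.hN i.D bd = β i.hN i.D i.hk y) :
    ‖cdB i U μ (cutMulY (hBdY i (hTY i c)) (O (cutMulY (hBdY i (hTY i c)) Λ))) bd‖
      ≤ B₀ * (1 + 5 * C1F d ℓ * (((ℓ : ℝ) + 1) * Real.exp δ) / (8 * (i.Mh : ℝ))) * (geo9K i).len y * Real.exp (-(δ * (geo9K i).dist y y'))
          * (geo9K i).supNorm (Sum.inr J) := by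
  obtain ⟨_, hMh2, hR2, _⟩ := side_conditions i
  have hC1F : 0 ≤ C1F d ℓ := C1F_nonneg d ℓ
  have hL1 : (1 : ℝ) ≤ (ℓ : ℝ) + 1 := by linarith [(Nat.cast_nonneg ℓ : (0 : ℝ) ≤ ℓ)]
  have hL0 : (0 : ℝ) < (ℓ : ℝ) + 1 := by linarith
  have hMh0 : (0 : ℝ) < (i.Mh : ℝ) := by exact_mod_cast (B9GeoLemma21KLevelV1.one_le_Mh i)
  have hη0 : 0 < etaS i := etaS_pos i
  have hcf0 : 0 < |i.cf| := by
    have h := hη0; rw [hη] at h; exact inv_pos.1 h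
  have hF0 : 0 ≤ (geo9K i).supNorm (Sum.inr J) := geo9K_supNorm_nonneg i _
  set E : ℝ := Real.exp (-(δ * (geo9K i).dist y y')) with hEdef
  have hE0 : 0 ≤ E := (Real.exp_pos _).le
  -- the cut-off and the class
  have hh1 : ∀ x : FBondY i, |hBdY i (hTY i c) x| ≤ 1 := fun x =>
    abs_hT_le_one i.D (B9GeoLemma21KLevelV1.one_le_Mh i) (B9GeoLemma21KLevelV1.one_le_P i) c _
  have hΛ' : ∀ x, ‖cutMulY (𝔸 := 𝔸) (hBdY i (hTY i c)) Λ x‖ ≤ |J x| := norm_cutMulY_le_of_le hh1 hΛ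
  -- the chart points of the bond and of its shift
  set z : SiteY i := chartY i bd.src with hzdef
  have hz' : chartY i (bd.src.shift μ) = shiftY i μ z := (shiftY_chartY i μ bd.src).symm
  have hbz : blkOf i.D.toDomains z = β i.hN i.D i.hk y := hb
  -- the neighbour bond `b′ = ⟨b₋ + e_μ, ν⟩` and its block
  set bd' : FBondY i := ⟨bd.src.shift μ, bd.dir⟩ with hbd'
  set y₁ : IBondY i := ιB (blkV1 i.hN i.D bd') with hy₁
  have hb' : blkV1 i.hN i.D bd' = β i.hN i.D i.hk y₁ := by rw [hy₁, hι]
  have hbz' : blkOf i.D.toDomains (shiftY i μ z) = β i.hN i.D i.hk y₁ := by rw [← hz']; exact hb'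
  -- lengths on the two blocks
  have hleny : (geo9K i).len y = ((ℓ : ℝ) + 1) ^ levY i z * etaS i := len_eq_pow_mul_eta i hη hbz
  have hleny₁ : (geo9K i).len y₁ = ((ℓ : ℝ) + 1) ^ levY i (shiftY i μ z) * etaS i := len_eq_pow_mul_eta i hη hbz'
  -- one step: level and distance
  have htouch : torusSupNorm (toKT i).NB (z.1 - (shiftY i μ z).1) ≤ 1 := (torusSupNorm_sub_shiftY_le_one i μ z).1
  have hlev1 : levY i (shiftY i μ z) ≤ levY i z + 1 := lev_le_succ_of_touch i htouch
  have hlen1 : (geo9K i).len y₁ ≤ ((ℓ : ℝ) + 1) * (geo9K i).len y := by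
    rw [hleny, hleny₁]
    calc ((ℓ : ℝ) + 1) ^ levY i (shiftY i μ z) * etaS i ≤ ((ℓ : ℝ) + 1) ^ (levY i z + 1) * etaS i :=
          mul_le_mul_of_nonneg_right (pow_le_pow_right₀ hL1 hlev1) hη0.le
      _ = ((ℓ : ℝ) + 1) * (((ℓ : ℝ) + 1) ^ levY i z * etaS i) := by rw [pow_succ]; ring
  have hdist : (geo9K i).dist y y' ≤ 1 + (geo9K i).dist y₁ y' := by
    rw [geo9K_dist_eq, geo9K_dist_eq, ← hbz, ← hbz']
    have hconn := connectedT (D := i.D) (B9GeoLemma21KLevelV1.one_le_Mh i) (B9GeoLemma21KLevelV1.one_le_P i)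
    have htri := hconn.dist_triangle (u := blkOf i.D.toDomains z) (v := blkOf i.D.toDomains (shiftY i μ z)) (w := β i.hN i.D i.hk y')
    have h1' := dist_blkOf_le_one_of_touch i htouch
    have e : ((bondT i.D).dist (blkOf i.D.toDomains z) (β i.hN i.D i.hk y') : ℝ)
        ≤ ((bondT i.D).dist (blkOf i.D.toDomains z) (blkOf i.D.toDomains (shiftY i μ z)) : ℝ)
          + ((bondT i.D).dist (blkOf i.D.toDomains (shiftY i μ z)) (β i.hN i.D i.hk y') : ℝ) := by exact_mod_cast htri
    have h1r : ((bondT i.D).dist (blkOf i.D.toDomains z) (blkOf i.D.toDomains (shiftY i μ z)) : ℝ) ≤ 1 := by exact_mod_cast h1'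
    linarith
  have hexp : Real.exp (-(δ * (geo9K i).dist y₁ y')) ≤ Real.exp δ * E := by
    rw [hEdef, ← Real.exp_add]
    have := mul_le_mul_of_nonneg_left hdist hδ
    exact Real.exp_le_exp.2 (by linarith)
  -- (3.100)
  rw [cdB_cutMulY_apply]
  refine (norm_add_le _ _).trans ?_
  -- first term: the gradient entry through `|h_□(b₋)| ≤ 1`
  have T1 : ‖((hBdY i (hTY i c) bd : ℝ) : ℂ) • cdB i U μ (O (cutMulY (hBdY i (hTY i c)) Λ)) bd‖ ≤ B₀ * (geo9K i).len y * E * (geo9K i).supNorm (Sum.inr J) := by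
    rw [norm_smul, Complex.norm_real, Real.norm_eq_abs]
    calc |hBdY i (hTY i c) bd| * ‖cdB i U μ (O (cutMulY (hBdY i (hTY i c)) Λ)) bd‖
        ≤ 1 * (B₀ * (geo9K i).len y * E * (geo9K i).supNorm (Sum.inr J)) :=
          mul_le_mul (hh1 bd) (h342₁ J y y' hs _ hΛ' bd μ hb) (norm_nonneg _) zero_le_one
      _ = _ := one_mul _
  -- second term: the commutator piece, read in the neighbour block
  have T2 : ‖((i.cf * (hTY i c (chartY i (bd.src.shift μ)) - hTY i c (chartY i bd.src)) : ℝ) : ℂ) •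
        R (U μ bd.src) (O (cutMulY (hBdY i (hTY i c)) Λ) ⟨bd.src.shift μ, bd.dir⟩)‖
      ≤ B₀ * (5 * C1F d ℓ * (((ℓ : ℝ) + 1) * Real.exp δ) / (8 * (i.Mh : ℝ))) * (geo9K i).len y * E * (geo9K i).supNorm (Sum.inr J) := by
    rw [norm_smul, Complex.norm_real, Real.norm_eq_abs, hz', abs_mul]
    -- the value entry at `b′`
    have hval : ‖R (U μ bd.src) (O (cutMulY (hBdY i (hTY i c)) Λ) bd')‖ ≤ B₀ * (geo9K i).len y₁ ^ 2 * Real.exp (-(δ * (geo9K i).dist y₁ y'))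
        * (geo9K i).supNorm (Sum.inr J) :=
      (norm_R_le (hU μ bd.src).1 (hU μ bd.src).2 _).trans (h342₀ J y₁ y' hs _ hΛ' bd' hb')
    by_cases h0 : hTY i c (shiftY i μ z) - hTY i c z = 0
    · rw [← hzdef, h0, abs_zero, mul_zero, zero_mul]
      exact mul_nonneg (mul_nonneg (mul_nonneg (mul_nonneg hB₀ (by positivity)) (B9GeoLemma21KLevelV1.geo9K_len_pos i y).le) hE0) hF0
    · -- one step from `supp h_□`: `lev(z + e_μ) ≤ j + 1`
      have hnear : levY i (shiftY i μ z) ≤ c.1.1 + 1 := by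
        by_cases hz0 : hTY i c (shiftY i μ z) = 0
        · have hzz : hTY i c z ≠ 0 := fun h => h0 (by rw [hz0, h, sub_zero])
          have ht' : torusSupNorm (toKT i).NB ((shiftY i μ z).1 - z.1) ≤ 1 := by
            have h2 := (torusSupNorm_sub_shiftY_le_one i μ (shiftY i μ z)).2
            simpa only [Equiv.symm_apply_apply] using h2
          exact (mem_QT_and_lev_of_near i c hzz ht').2
        · exact (mem_QT_and_lev_of_near i c hz0 (torusSupNorm_sub_self_le_one i _)).2
      -- the Lipschitz size of the cut-off and the bookkeeping
      have hLip : |hTY i c (shiftY i μ z) - hTY i c z| ≤ C1F d ℓ / (8 / 5 * (bigSide ℓ i.Mh c.1.1 : ℝ)) := abs_hTY_shiftY_sub_le i c μ z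
      have hS : (bigSide ℓ i.Mh c.1.1 : ℝ) = ((ℓ : ℝ) + 1) ^ c.1.1 * ((i.Mh : ℝ) * ((ℓ : ℝ) + 1)) := by
        rw [bigSide_eq]; push_cast; ring
      have hS0 : 0 < (bigSide ℓ i.Mh c.1.1 : ℝ) := by rw [hS]; positivity
      have hpow : ((ℓ : ℝ) + 1) ^ levY i (shiftY i μ z) ≤ ((ℓ : ℝ) + 1) ^ (c.1.1 + 1) := pow_le_pow_right₀ hL1 hnear
      -- |c_f|·ℓ(y₁)² = L^{lev b′}·ℓ(y₁)
      have hcfl : |i.cf| * (geo9K i).len y₁ ^ 2 = ((ℓ : ℝ) + 1) ^ levY i (shiftY i μ z) * (geo9K i).len y₁ := by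
        rw [hleny₁, hη]
        field_simp
      -- L^{lev b′}∕S_j ≤ 1∕M_h
      have hratio : C1F d ℓ / (8 / 5 * (bigSide ℓ i.Mh c.1.1 : ℝ)) * ((ℓ : ℝ) + 1) ^ levY i (shiftY i μ z) ≤ 5 * C1F d ℓ / (8 * (i.Mh : ℝ)) := by
        rw [div_mul_eq_mul_div, div_le_div_iff₀ (mul_pos (by norm_num) hS0) (mul_pos (by norm_num) hMh0), hS]
        have hC := C1F_nonneg d ℓ
        calc C1F d ℓ * ((ℓ : ℝ) + 1) ^ levY i (shiftY i μ z) * (8 * (i.Mh : ℝ))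
            ≤ C1F d ℓ * ((ℓ : ℝ) + 1) ^ (c.1.1 + 1) * (8 * (i.Mh : ℝ)) :=
              mul_le_mul_of_nonneg_right (mul_le_mul_of_nonneg_left hpow hC) (by positivity)
          _ = 5 * C1F d ℓ * (8 / 5 * (((ℓ : ℝ) + 1) ^ c.1.1 * ((i.Mh : ℝ) * ((ℓ : ℝ) + 1)))) := by rw [pow_succ]; ring
      calc |i.cf| * |hTY i c (shiftY i μ z) - hTY i c z| * ‖R (U μ bd.src) (O (cutMulY (hBdY i (hTY i c)) Λ) bd')‖
          ≤ |i.cf| * (C1F d ℓ / (8 / 5 * (bigSide ℓ i.Mh c.1.1 : ℝ))) *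
              (B₀ * (geo9K i).len y₁ ^ 2 * Real.exp (-(δ * (geo9K i).dist y₁ y')) * (geo9K i).supNorm (Sum.inr J)) :=
            mul_le_mul (mul_le_mul_of_nonneg_left hLip hcf0.le) hval (norm_nonneg _) (mul_nonneg hcf0.le (div_nonneg (C1F_nonneg d ℓ) (by positivity)))
        _ = (C1F d ℓ / (8 / 5 * (bigSide ℓ i.Mh c.1.1 : ℝ)) * ((ℓ : ℝ) + 1) ^ levY i (shiftY i μ z)) * B₀ * (geo9K i).len y₁
              * Real.exp (-(δ * (geo9K i).dist y₁ y')) * (geo9K i).supNorm (Sum.inr J) := by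
            have e : |i.cf| * (C1F d ℓ / (8 / 5 * (bigSide ℓ i.Mh c.1.1 : ℝ))) *
                (B₀ * (geo9K i).len y₁ ^ 2 * Real.exp (-(δ * (geo9K i).dist y₁ y')) * (geo9K i).supNorm (Sum.inr J))
                = (C1F d ℓ / (8 / 5 * (bigSide ℓ i.Mh c.1.1 : ℝ))) * B₀ * (|i.cf| * (geo9K i).len y₁ ^ 2)
                  * Real.exp (-(δ * (geo9K i).dist y₁ y')) * (geo9K i).supNorm (Sum.inr J) := by ring
            rw [e, hcfl]; ring
        _ ≤ (5 * C1F d ℓ / (8 * (i.Mh : ℝ))) * B₀ * (((ℓ : ℝ) + 1) * (geo9K i).len y) * (Real.exp δ * E) * (geo9K i).supNorm (Sum.inr J) := by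
            refine mul_le_mul_of_nonneg_right ?_ hF0
            have hq0 : 0 ≤ 5 * C1F d ℓ / (8 * (i.Mh : ℝ)) * B₀ := mul_nonneg (div_nonneg (by positivity) (by positivity)) hB₀
            refine mul_le_mul ?_ hexp (Real.exp_pos _).le
              (mul_nonneg hq0 (mul_nonneg hL0.le (B9GeoLemma21KLevelV1.geo9K_len_pos i y).le))
            exact mul_le_mul (mul_le_mul_of_nonneg_right hratio hB₀) hlen1 (B9GeoLemma21KLevelV1.geo9K_len_pos i y₁).le hq0
        _ = _ := by ring
  calc ‖((hBdY i (hTY i c) bd : ℝ) : ℂ) • cdB i U μ (O (cutMulY (hBdY i (hTY i c)) Λ)) bd‖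
        + ‖((i.cf * (hTY i c (chartY i (bd.src.shift μ)) - hTY i c (chartY i bd.src)) : ℝ) : ℂ) •
            R (U μ bd.src) (O (cutMulY (hBdY i (hTY i c)) Λ) ⟨bd.src.shift μ, bd.dir⟩)‖
      ≤ B₀ * (geo9K i).len y * E * (geo9K i).supNorm (Sum.inr J)
        + B₀ * (5 * C1F d ℓ * (((ℓ : ℝ) + 1) * Real.exp δ) / (8 * (i.Mh : ℝ))) * (geo9K i).len y * E * (geo9K i).supNorm (Sum.inr J) :=
        add_le_add T1 T2
    _ = _ := by ring

end Pointwise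

/-! ## §2 Localization: the term vanishes unless `Δ(b)` is within one admissible bond of the reach set `QT □` -/

section Support

variable (U : CfgY 𝔸 i) (O : (FBondY i → 𝔸) →ₗ[ℂ] (FBondY i → 𝔸))

/-- **the forward gradient of `h_□Ψ` vanishes away from `supp h_□`**: if `h_□(b₋) = 0` and `h_□(b₋+e_μ) = 0` then `∇_{U,μ}(h_□Ψ)(b) = 0` ((3.100)).
[cite: Balaban1985BackgroundPropagators, (3.100) p.413] -/
theorem cdB_hMul_apply_eq_zero_of_far (h : SiteY i → ℝ) (Ψ : FBondY i → 𝔸) (μ : Fin (d + 1)) (bd : FBondY i)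
    (h0 : h (chartY i bd.src) = 0) (h1 : h (chartY i (bd.src.shift μ)) = 0) : cdB i U μ (cutMulY (hBdY i h) Ψ) bd = 0 := by
  rw [cdB_cutMulY_apply, hBdY_apply, h0, h1, sub_zero, mul_zero, Complex.ofReal_zero, zero_smul, zero_smul, add_zero]

/-- **WHERE THE TERM LIVES**: if `∇_{U,μ}(h_□O(h_□Λ))(b) ≠ 0` then `h_□(b₋) ≠ 0` or `h_□(b₋+e_μ) ≠ 0`, so `Δ(b)` is within one admissible bond of a block of `QT □`
(`supp h_□ ⊂ QT □`: `blkOf_mem_QT_of_hT_ne_zero`; touching blocks: `dist_blkOf_le_one_of_touch`) — inside FILE 3-B's localisation set (radius `2L+4`).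
[cite: Balaban1985BackgroundPropagators, (3.100) p.413, (3.87) p.409; Balaban1984PropagatorsII, p.235, (2.46) p.231] -/
theorem exists_nearQT_of_cdB_hOh_ne_zero (c : ↥(cubes i.D.toDomains)) (Ψ : FBondY i → 𝔸) (μ : Fin (d + 1)) (bd : FBondY i)
    (hne : cdB i U μ (cutMulY (hBdY i (hTY i c)) Ψ) bd ≠ 0) :
    ∃ yq ∈ QT i.D (B9GeoLemma21KLevelV1.one_le_Mh i) (four_le_P' i) c,
      (((bondT i.D).dist (blkV1 i.hN i.D bd) yq : ℕ) : ℝ) ≤ 2 * (ℓ : ℝ) + 6 := by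
  obtain ⟨_, hMh2, hR2, _⟩ := side_conditions i
  have hℓ0 : (0 : ℝ) ≤ 2 * (ℓ : ℝ) + 6 := by positivity
  by_cases h0 : hTY i c (chartY i bd.src) = 0
  · have h1 : hTY i c (chartY i (bd.src.shift μ)) ≠ 0 := fun h1 => hne (cdB_hMul_apply_eq_zero_of_far i U (hTY i c) Ψ μ bd h0 h1)
    rw [← shiftY_chartY] at h1
    refine ⟨blkOf i.D.toDomains (shiftY i μ (chartY i bd.src)), blkOf_mem_QT_of_hT_ne_zero hMh2 hR2 (four_le_P' i) c h1, ?_⟩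
    have h1' := dist_blkOf_le_one_of_touch i (torusSupNorm_sub_shiftY_le_one i μ (chartY i bd.src)).1
    have h1r : (((bondT i.D).dist (blkOf i.D.toDomains (chartY i bd.src)) (blkOf i.D.toDomains (shiftY i μ (chartY i bd.src))) : ℕ) : ℝ) ≤ 1 := by
      exact_mod_cast h1'
    have hℓ1 : (1 : ℝ) ≤ 2 * (ℓ : ℝ) + 6 := by linarith [(Nat.cast_nonneg ℓ : (0 : ℝ) ≤ ℓ)]
    exact h1r.trans hℓ1
  · refine ⟨blkOf i.D.toDomains (chartY i bd.src), blkOf_mem_QT_of_hT_ne_zero hMh2 hR2 (four_le_P' i) c h0, ?_⟩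
    have e : (bondT i.D).dist (blkV1 i.hN i.D bd) (blkOf i.D.toDomains (chartY i bd.src)) = 0 := SimpleGraph.dist_self
    rw [e, Nat.cast_zero]
    exact hℓ0

end Support

/-! ## §3 The block majorant of the conjugated gradient term (FILE 2-B's `hTE μ □` at `GACubeY`) and its sum over the cover (`hKE μ`) -/

section Majorant

variable [Fintype (geo9K i).Site] {Rr : ℝ} {Hp : Prop}
variable (ιB : BlkY i → IBondY i)
variable {B : B9.Backgrounds} (cfg : B.Cfg → CfgY 𝔸 i) (par : BondParY 𝔸 i) {U₁ : B.Cfg}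

/-- ★★ **THE `hTE μ □` INPUT OF FILE 2-B AT THE CUBE LETTER `G_□(U) = GACubeY`, FROM ITS (3.42) BLOCK OVER THE CLASS**: for any ℝ-linear `D` agreeing pointwise with
`∇_{U,μ}` at `U = cfg U₁`, `conj b(D)·(h_□·conj b G_□(U)·h_□)` has the localized block majorant
`1_{S′_□}(a)·M₂(Σ‖b_j‖)·B₀(1 + 5C1F·L·e^{δ}∕(8M_h))·ℓ(a)·e^{−δd(a,a′)}`, `S′_□ = {a : ∃ y ∈ QT □, d_T(βa, y) ≤ 2L+4}` (FILE 3-B's localisation) —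
`hasMajorant_conj_of_ball_boundB` on §1's bound, localized by §2. [cite: Balaban1985BackgroundPropagators, (3.100) p.413, Thm 3.3 (3.42)₂ pp.397–399, (3.87) p.409; Balaban1984PropagatorsII, (2.51)–(2.52) p.232] -/
theorem hasMajorant_conj_gradTermB (hι : ∀ s, β i.hN i.D i.hk (ιB s) = s)
    {M₂ : ℝ} (hM₂ : 0 ≤ M₂) (hrepr : ∀ (v : 𝔸) (j : ι), |b.repr v j| ≤ M₂ * ‖v‖) (hη : etaS i = |i.cf|⁻¹)
    (parS : SiteParY 𝔸 i) (parB : BondParY 𝔸 i) {B₀ δ : ℝ} (hB₀ : 0 ≤ B₀) (hδ : 0 ≤ δ)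
    (c : ↥(cubes i.D.toDomains)) (hE : EBlock (kernelFamilyBInv i B cfg (GACubeY i c parS parB) par) B₀ δ U₁)
    (hU : ∀ μ x, ‖(cfg U₁ μ x : 𝔸)‖ ≤ 1 ∧ ‖(((cfg U₁ μ x)⁻¹ : 𝔸ˣ) : 𝔸)‖ ≤ 1)
    (μ : Fin (d + 1)) (D : Module.End ℝ (FBondY i → 𝔸)) (hD : ∀ Λ, D Λ = cdB i (cfg U₁) μ Λ) :
    HasMajorant (g := toB6 (geo9K i) Rr Hp) (fun p : FBondY i × ι => ιB (blkV1 i.hN i.D p.1))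
      (conj b D * (mulOp (fun p : FBondY i × ι => hBdY i (hTY i c) p.1) * conj b ((GACubeY i c parS parB (cfg U₁)).restrictScalars ℝ) *
        mulOp (fun p : FBondY i × ι => hBdY i (hTY i c) p.1)))
      (fun a a' => if (∃ y ∈ QT i.D (B9GeoLemma21KLevelV1.one_le_Mh i) (four_le_P' i) c,
          (((bondT i.D).dist (β i.hN i.D i.hk a) y : ℕ) : ℝ) ≤ 2 * (ℓ : ℝ) + 6)
        then M₂ * (∑ j, ‖b j‖) * (B₀ * (1 + 5 * C1F d ℓ * (((ℓ : ℝ) + 1) * Real.exp δ) / (8 * (i.Mh : ℝ)))) * (geo9K i).len a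
          * Real.exp (-(δ * (geo9K i).dist a a')) else 0) := by
  classical
  -- the operator as ONE conjugated ℝ-linear letter
  set Rl : Module.End ℝ (FBondY i → 𝔸) := D * ((cutMulY (𝔸 := 𝔸) (hBdY i (hTY i c))).restrictScalars ℝ *
    (GACubeY i c parS parB (cfg U₁)).restrictScalars ℝ * (cutMulY (𝔸 := 𝔸) (hBdY i (hTY i c))).restrictScalars ℝ) with hRl
  have hRl_apply : ∀ Λ, Rl Λ = cdB i (cfg U₁) μ (cutMulY (hBdY i (hTY i c)) (GACubeY i c parS parB (cfg U₁) (cutMulY (hBdY i (hTY i c)) Λ))) :=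
    fun Λ => by simp only [hRl, Module.End.mul_apply, LinearMap.restrictScalars_apply, hD]
  have hconj : conj b Rl = conj b D * (mulOp (fun p : FBondY i × ι => hBdY i (hTY i c) p.1) *
      conj b ((GACubeY i c parS parB (cfg U₁)).restrictScalars ℝ) * mulOp (fun p : FBondY i × ι => hBdY i (hTY i c) p.1)) := by
    rw [hRl, B9Eq352DivFormLetters.conj_mul, B9Eq352DivFormLetters.conj_mul, B9Eq352DivFormLetters.conj_mul, conj_cutMulY]
  rw [← hconj]
  have hT : ∀ (cx : ℂ) (Λ : FBondY i → 𝔸), Rl (cx • Λ) = cx • Rl Λ := fun cx Λ => by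
    rw [hRl_apply, hRl_apply, map_smul, map_smul, map_smul, ← cdBC_apply, ← cdBC_apply, map_smul]
  have hC1F : 0 ≤ C1F d ℓ := C1F_nonneg d ℓ
  have hA₀ : 0 ≤ B₀ * (1 + 5 * C1F d ℓ * (((ℓ : ℝ) + 1) * Real.exp δ) / (8 * (i.Mh : ℝ))) := mul_nonneg hB₀ (by positivity)
  have hW0 : ∀ a a' : IBondY i, 0 ≤ (if (∃ y ∈ QT i.D (B9GeoLemma21KLevelV1.one_le_Mh i) (four_le_P' i) c,
        (((bondT i.D).dist (β i.hN i.D i.hk a) y : ℕ) : ℝ) ≤ 2 * (ℓ : ℝ) + 6)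
      then (B₀ * (1 + 5 * C1F d ℓ * (((ℓ : ℝ) + 1) * Real.exp δ) / (8 * (i.Mh : ℝ)))) * (geo9K i).len a * Real.exp (-(δ * (geo9K i).dist a a'))
      else 0) := fun a a' =>
    ite_nonneg (mul_nonneg (mul_nonneg hA₀ (B9GeoLemma21KLevelV1.geo9K_len_pos i a).le) (Real.exp_nonneg _)) le_rfl
  refine hasMajorant_mono (g := toB6 (geo9K i) Rr Hp) _
    (hasMajorant_conj_of_ball_boundB i b (Rr := Rr) (Hp := Hp) Rl hT ιB hι hM₂ hrepr _ hW0 fun J y y' hs E hE1 x hx => ?_)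
    fun a a' => le_of_eq ?_
  · -- the ball bound at `x ∈ Δ(βy)`, split on the localisation set
    rw [hRl_apply]
    by_cases hmem : ∃ yq ∈ QT i.D (B9GeoLemma21KLevelV1.one_le_Mh i) (four_le_P' i) c,
        (((bondT i.D).dist (β i.hN i.D i.hk y) yq : ℕ) : ℝ) ≤ 2 * (ℓ : ℝ) + 6
    · rw [if_pos hmem]
      exact norm_cdB_hOh_le i (cfg U₁) (GACubeY i c parS parB (cfg U₁)) c hB₀ hδ hη ιB hι hU
        (h342₀_of_eBlockInvB i b cfg (GACubeY i c parS parB) par hE hM₂ hrepr)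
        (h342₁_of_eBlockInvB i b cfg (GACubeY i c parS parB) par hE hM₂ hrepr) J y y' hs (liftY J E) (norm_liftY_le_abs i J hE1) μ x hx
    · rw [if_neg hmem, zero_mul]
      refine le_of_eq (norm_eq_zero.2 ?_)
      by_contra hne
      obtain ⟨yq, hyq, hdq⟩ := exists_nearQT_of_cdB_hOh_ne_zero i (cfg U₁) c _ μ x hne
      rw [hx] at hdq
      exact hmem ⟨yq, hyq, hdq⟩
  · by_cases h : ∃ yq ∈ QT i.D (B9GeoLemma21KLevelV1.one_le_Mh i) (four_le_P' i) c,
        (((bondT i.D).dist (β i.hN i.D i.hk a) yq : ℕ) : ℝ) ≤ 2 * (ℓ : ℝ) + 6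
    · rw [if_pos h, if_pos h]; ring
    · rw [if_neg h, if_neg h, mul_zero]

omit [CompleteSpace 𝔸] in
/-- ★★ **THE `hKE μ` BOUND OF FILE 2-B AT THE COVER OF RECORD**: the localized majorants of `hasMajorant_conj_gradTermB` summed over the cubes with FILE 3-B's overlap count
`N′ = 3·5^{d+1}·e^{αδ(2L+4)}·c₁(α)` (from (2.61), `0 ≤ αδ`): `Σ_□ K_{E,□}(a,a′) ≤ N′·M₂(Σ‖b_j‖)·B₀(1 + 5C1F·L·e^{δ}∕(8M_h))·ℓ(a)·e^{−δd(a,a′)}` — the `A₁` of FILE 2-B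
for the forward entries. [cite: Balaban1985BackgroundPropagators, (3.87) p.409, Thm 3.3 (3.42)₂ p.397; Balaban1984PropagatorsII, p.232, Lemma 2.1 (2.61) p.234, p.235] -/
theorem sum_gradTermB_majorant_le (hι : ∀ s, β i.hN i.D i.hk (ιB s) = s) {M₂ : ℝ} (hM₂ : 0 ≤ M₂) {B₀ δ : ℝ} (hB₀ : 0 ≤ B₀)
    (d' : ℕ) {α : ℝ} (hαδ : 0 ≤ α * δ) (h261 : Ineq261 d' (toB6 (geo9K i) Rr Hp) δ α) (a a' : IBondY i) :
    (∑ c : ↥(cubes i.D.toDomains),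
        (if (∃ y ∈ QT i.D (B9GeoLemma21KLevelV1.one_le_Mh i) (four_le_P' i) c,
            (((bondT i.D).dist (β i.hN i.D i.hk a) y : ℕ) : ℝ) ≤ 2 * (ℓ : ℝ) + 6)
          then M₂ * (∑ j, ‖b j‖) * (B₀ * (1 + 5 * C1F d ℓ * (((ℓ : ℝ) + 1) * Real.exp δ) / (8 * (i.Mh : ℝ)))) * (geo9K i).len a
            * Real.exp (-(δ * (geo9K i).dist a a')) else 0)) ≤
      (3 * 5 ^ (d + 1) * (Real.exp (α * δ * (2 * (ℓ : ℝ) + 6)) * B6.c1 d' δ α)) *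
          (M₂ * (∑ j, ‖b j‖) * (B₀ * (1 + 5 * C1F d ℓ * (((ℓ : ℝ) + 1) * Real.exp δ) / (8 * (i.Mh : ℝ))))) * (geo9K i).len a *
        Real.exp (-(δ * (geo9K i).dist a a')) := by
  classical
  have hC1F : 0 ≤ C1F d ℓ := C1F_nonneg d ℓ
  have hSb : 0 ≤ ∑ j, ‖b j‖ := Finset.sum_nonneg fun _ _ => norm_nonneg _
  have hK0 : 0 ≤ M₂ * (∑ j, ‖b j‖) * (B₀ * (1 + 5 * C1F d ℓ * (((ℓ : ℝ) + 1) * Real.exp δ) / (8 * (i.Mh : ℝ)))) * (geo9K i).len a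
      * Real.exp (-(δ * (geo9K i).dist a a')) :=
    mul_nonneg (mul_nonneg (mul_nonneg (mul_nonneg hM₂ hSb) (mul_nonneg hB₀ (by positivity)))
      (B9GeoLemma21KLevelV1.geo9K_len_pos i a).le) (Real.exp_nonneg _)
  have hterm : ∀ c : ↥(cubes i.D.toDomains),
      (if (∃ y ∈ QT i.D (B9GeoLemma21KLevelV1.one_le_Mh i) (four_le_P' i) c,
            (((bondT i.D).dist (β i.hN i.D i.hk a) y : ℕ) : ℝ) ≤ 2 * (ℓ : ℝ) + 6)
          then M₂ * (∑ j, ‖b j‖) * (B₀ * (1 + 5 * C1F d ℓ * (((ℓ : ℝ) + 1) * Real.exp δ) / (8 * (i.Mh : ℝ)))) * (geo9K i).len a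
            * Real.exp (-(δ * (geo9K i).dist a a')) else 0) =
      (if (∃ y ∈ QT i.D (B9GeoLemma21KLevelV1.one_le_Mh i) (four_le_P' i) c,
          (((bondT i.D).dist (β i.hN i.D i.hk a) y : ℕ) : ℝ) ≤ 2 * (ℓ : ℝ) + 6) then (1 : ℝ) else 0) *
        (M₂ * (∑ j, ‖b j‖) * (B₀ * (1 + 5 * C1F d ℓ * (((ℓ : ℝ) + 1) * Real.exp δ) / (8 * (i.Mh : ℝ)))) * (geo9K i).len a
          * Real.exp (-(δ * (geo9K i).dist a a'))) := by
    intro c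
    by_cases h : ∃ y ∈ QT i.D (B9GeoLemma21KLevelV1.one_le_Mh i) (four_le_P' i) c,
        (((bondT i.D).dist (β i.hN i.D i.hk a) y : ℕ) : ℝ) ≤ 2 * (ℓ : ℝ) + 6
    · rw [if_pos h, if_pos h, one_mul]
    · rw [if_neg h, if_neg h, zero_mul]
  rw [Finset.sum_congr rfl fun c _ => hterm c, ← Finset.sum_mul]
  calc (∑ c : ↥(cubes i.D.toDomains), if (∃ y ∈ QT i.D (B9GeoLemma21KLevelV1.one_le_Mh i) (four_le_P' i) c,
          (((bondT i.D).dist (β i.hN i.D i.hk a) y : ℕ) : ℝ) ≤ 2 * (ℓ : ℝ) + 6) then (1 : ℝ) else 0) *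
        (M₂ * (∑ j, ‖b j‖) * (B₀ * (1 + 5 * C1F d ℓ * (((ℓ : ℝ) + 1) * Real.exp δ) / (8 * (i.Mh : ℝ)))) * (geo9K i).len a
          * Real.exp (-(δ * (geo9K i).dist a a')))
      ≤ (3 * 5 ^ (d + 1) * (Real.exp (α * δ * (2 * (ℓ : ℝ) + 6)) * B6.c1 d' δ α)) *
        (M₂ * (∑ j, ‖b j‖) * (B₀ * (1 + 5 * C1F d ℓ * (((ℓ : ℝ) + 1) * Real.exp δ) / (8 * (i.Mh : ℝ)))) * (geo9K i).len a
          * Real.exp (-(δ * (geo9K i).dist a a'))) :=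
        mul_le_mul_of_nonneg_right (sum_indicator_nearQT_le i ιB hι d' hαδ h261 a) hK0
    _ = _ := by ring

end Majorant

end Literature.MathematicalPhysics.QuantumFieldTheory.Balaban1983to89.B9Thm310CutoffGradTermsB

end
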